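import Summits.NavierStokesRegularity.NavierStokesRegularity.Theorems.HodographBetchovFastClassSqueezeWeylSplitResolved
import Literature.Analysis.FluidPDE.LerayHopfProofs

/-!
# `FastClassSqueeze` (stmt-NavierStokesRegularity-15832): the crux follows from its subscale version

Route `HodographBetchov`, crux 3; idea card `Cruxes/FastClassSqueeze/Ideas/resolved-weyl-split.md`
(crux-ideate r1), transfer B1 + B2, companion of
`HodographBetchovFastClassSqueezeWeylSplitResolved.lean` (which proves B2, `resolved_rpow_le` /
`resolvedFastSqueeze`: the ball-averaged gradient `A_R = ⨍_{B̄_R(x)} ∇u(t)` is a-priori Miller-finite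
on the fast class for `q ≥ 3`).

`fastClassSqueeze_of_subscaleSqueeze`: the crux FOLLOWS from its SUBSCALE version — the same
statement with `∇u` replaced by the high-pass part `∇u − A_R` in the min–max clause and `q ≥ 3` —
because a plane on which the quadratic form of `∇u − A_R` is `≤ m` carries the form of `∇u` with bound
`m + ‖A_R‖` (Weyl, `plane_form_le_add_opNorm`), `(m + ‖A_R‖)^q ≤ 2^{q−1}(m^q + ‖A_R‖^q)`,
`(X + Y)^{2/(2q−3)} ≤ X^{2/(2q−3)} + Y^{2/(2q−3)}` (`2/(2q−3) ≤ 1`), and B2.  So on the window `q ≥ 3`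
the whole open content of the crux is the subscale middle strain of the fast fluid.

Measure-theoretic bookkeeping: the resolved gradient `x ↦ A_R(t,x)` is continuous
(`WeylSplit.continuous_setAverage_closedBall`), which supplies the measurability needed to split the
inner integral; in time, the explicit majorant `K(1 + ∫ |∇u(t)|²_F)` of B2, made measurable by a
piecewise extension (`exists_measurable_dissipation_slice`), is what allows the outer integral to
be split (lower Lebesgue integrals are not subadditive without measurability).
-/

noncomputable section

-- the summit and its single problem share the name `NavierStokesRegularity` (D-0017 nested layout)
set_option linter.dupNamespace false

namespace Summit.NavierStokesRegularity.NavierStokesRegularity.Theorems.FastClassSqueeze.WeylSplit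

open Set MeasureTheory Filter Topology Metric Literature.Analysis.FluidPDE
open scoped ENNReal NNReal RealInnerProductSpace

/-! ### B1 + B2: the crux follows from its subscale version -/

/-- **Weyl on a fixed plane.** If the quadratic form of `A − B` on the span of an orthonormal pair
`v, w` is `≤ m (α² + β²)`, then the form of `A` there is `≤ (m + ‖B‖)(α² + β²)`
(`⟪Aξ,ξ⟫ = ⟪(A−B)ξ,ξ⟫ + ⟪Bξ,ξ⟫ ≤ m‖ξ‖² + ‖B‖‖ξ‖²`). [cite: HornJohnson2013, Thm 4.3.1] -/
theorem plane_form_le_add_opNorm {A B : EuclideanSpace ℝ (Fin 3) →L[ℝ] EuclideanSpace ℝ (Fin 3)}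
    {v w : EuclideanSpace ℝ (Fin 3)} (hv : ‖v‖ = 1) (hw : ‖w‖ = 1) (hvw : inner ℝ v w = 0) {m : ℝ}
    (h : ∀ α β : ℝ, inner ℝ ((A - B) (α • v + β • w)) (α • v + β • w) ≤ m * (α ^ 2 + β ^ 2))
    (α β : ℝ) :
    inner ℝ (A (α • v + β • w)) (α • v + β • w) ≤ (m + ‖B‖) * (α ^ 2 + β ^ 2) := by
  have hξ : ‖α • v + β • w‖ ^ 2 = α ^ 2 + β ^ 2 := norm_sq_smul_add_smul hv hw hvw α β
  have hsplit : inner ℝ (A (α • v + β • w)) (α • v + β • w) =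
      inner ℝ ((A - B) (α • v + β • w)) (α • v + β • w) +
        inner ℝ (B (α • v + β • w)) (α • v + β • w) := by
    rw [sub_apply, inner_sub_left]
    ring
  have hB : inner ℝ (B (α • v + β • w)) (α • v + β • w) ≤ ‖B‖ * (α ^ 2 + β ^ 2) := by
    calc inner ℝ (B (α • v + β • w)) (α • v + β • w)
        ≤ ‖B (α • v + β • w)‖ * ‖α • v + β • w‖ := real_inner_le_norm _ _
      _ ≤ (‖B‖ * ‖α • v + β • w‖) * ‖α • v + β • w‖ :=
          mul_le_mul_of_nonneg_right (B.le_opNorm _) (norm_nonneg _)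
      _ = ‖B‖ * (α ^ 2 + β ^ 2) := by rw [← hξ]; ring
  rw [hsplit, add_mul]
  exact add_le_add (h α β) hB

/-- A measurable-in-time extension of the dissipation slice `t ↦ ∫ |∇u(t)|²_F`: the piecewise field
`(t,y) ↦ |∇u(t,y)|²_F` on `(0,T) × ℝ³`, `0` elsewhere, is jointly measurable (it is continuous on the
measurable slab), so its `y`-integral is measurable in `t` (Tonelli). [folklore] -/
theorem exists_measurable_dissipation_slice {ν T : ℝ}
    {u : ℝ → EuclideanSpace ℝ (Fin 3) → EuclideanSpace ℝ (Fin 3)}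
    {p : ℝ → EuclideanSpace ℝ (Fin 3) → ℝ}
    (hcl : IsClassicalNSSolutionOn (Ico 0 T) ν 0 u p) :
    ∃ Gm : ℝ → ℝ≥0∞, Measurable Gm ∧
      ∀ t ∈ Ioo 0 T, Gm t = ∫⁻ y, ENNReal.ofReal (frobeniusNormSq (fderiv ℝ (u t) y)) := by
  classical
  set S : Set (ℝ × EuclideanSpace ℝ (Fin 3)) := Ioo 0 T ×ˢ univ with hS
  have hSm : MeasurableSet S := measurableSet_Ioo.prod MeasurableSet.univ
  set g : ℝ × EuclideanSpace ℝ (Fin 3) → ℝ≥0∞ :=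
    fun z => ENNReal.ofReal (frobeniusNormSq (fderiv ℝ (u z.1) z.2)) with hg
  have hDcont : ContinuousOn
      (fun z : ℝ × EuclideanSpace ℝ (Fin 3) => fderiv ℝ (u z.1) z.2) (Ico 0 T ×ˢ univ) :=
    (hcl.smooth_velocity.fderiv_slice (uniqueDiffOn_Ico 0 T)).continuousOn
  have hgcont : ContinuousOn g S := by
    refine ((ENNReal.continuous_ofReal.comp LerayHopfProofs.continuous_frobeniusNormSq).comp_continuousOn
      hDcont).mono ?_
    exact prod_mono Ioo_subset_Ico_self Subset.rfl
  have hpw : Measurable (S.piecewise g fun _ => 0) :=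
    hgcont.measurable_piecewise continuousOn_const hSm
  refine ⟨fun t => ∫⁻ y, S.piecewise g (fun _ => 0) (t, y), hpw.lintegral_prod_right',
    fun t ht => ?_⟩
  refine lintegral_congr fun y => ?_
  have hmem : (t, y) ∈ S := ⟨ht, mem_univ _⟩
  rw [piecewise_eq_of_mem _ _ _ hmem]

/-- **`FastClassSqueeze` follows from its subscale version** (idea `resolved-weyl-split`, transfer
B1 + B2).  Suppose that along every classical solution of unforced Navier–Stokes on `ℝ³ × [0,T)`
that is Leray–Hopf from a rapidly decaying datum there are a level `l > 0`, a resolution `R > 0`, an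
exponent `q ≥ 3` and a nonnegative `m` majorising, in min–max form on the fast class `{|u| > l}`, the
quadratic form of the HIGH-PASS gradient `∇u(t,x) − ⨍_{B̄_R(x)} ∇u(t)`, with
`∫₀ᵀ (∫_{|u|>l} m^q)^{2/(2q−3)} < ∞`.  Then `FastClassSqueeze` holds, with the same `l, q` and the
majorant `m + ‖⨍_{B̄_R(x)} ∇u(t)‖`: the plane that works for the high-pass part works for `∇u` with
that bound (`plane_form_le_add_opNorm`), `(m + a)^q ≤ 2^{q−1}(m^q + a^q)`, the inner integrals split
(the resolved gradient is continuous in `x`, `continuous_setAverage_closedBall`), `2/(2q−3) ≤ 1`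
makes the outer power subadditive, and the resolved half is finite by B2 (`resolved_rpow_le`, through
its measurable-in-time majorant `K(1 + ∫|∇u(t)|²_F)`). [cite: Constantin1990, §2 eq. (2.21)] -/
theorem fastClassSqueeze_of_subscaleSqueeze :
    (∀ (ν T : ℝ), 0 < ν → 0 < T →
      ∀ (u : ℝ → EuclideanSpace ℝ (Fin 3) → EuclideanSpace ℝ (Fin 3))
        (p : ℝ → EuclideanSpace ℝ (Fin 3) → ℝ),
        Literature.Analysis.FluidPDE.IsClassicalNSSolutionOn (Set.Ico 0 T) ν 0 u p →
        Literature.Analysis.FluidPDE.IsLerayHopfOn T ν 0 (u 0) u →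
        Literature.Analysis.FluidPDE.HasRapidSpatialDecay (u 0) →
        ∃ l : ℝ, 0 < l ∧ ∃ R : ℝ, 0 < R ∧ ∃ q : ℝ, 3 ≤ q ∧
          ∃ m : ℝ → EuclideanSpace ℝ (Fin 3) → ℝ, (∀ t x, 0 ≤ m t x) ∧
          (∀ t ∈ Set.Ico 0 T, ∀ x, l < ‖u t x‖ → ∃ v w : EuclideanSpace ℝ (Fin 3),
            ‖v‖ = 1 ∧ ‖w‖ = 1 ∧ inner ℝ v w = 0 ∧
            ∀ α β : ℝ, inner ℝ ((fderiv ℝ (u t) x - ⨍ y in Metric.closedBall x R, fderiv ℝ (u t) y)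
              (α • v + β • w)) (α • v + β • w) ≤ m t x * (α ^ 2 + β ^ 2)) ∧
          ∫⁻ t in Set.Ioo 0 T, (∫⁻ x in {x : EuclideanSpace ℝ (Fin 3) | l < ‖u t x‖},
            ENNReal.ofReal (m t x) ^ q) ^ (2 / (2 * q - 3)) < ⊤) →
    Summit.NavierStokesRegularity.NavierStokesRegularity.Theses.HodographBetchov.FastClassSqueeze := by
  intro hsub ν T hν hT u p hcl hLH hdec
  obtain ⟨l, hl, R, hR, q, hq, m, hm0, hclause, hint⟩ := hsub ν T hν hT u p hcl hLH hdec
  -- notation: the resolved gradient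
  set A : ℝ → EuclideanSpace ℝ (Fin 3) → (EuclideanSpace ℝ (Fin 3) →L[ℝ] EuclideanSpace ℝ (Fin 3)) :=
    fun t x => ⨍ y in closedBall x R, fderiv ℝ (u t) y with hA
  have hq32 : 3 / 2 < q := by linarith
  have hq1 : 1 ≤ q := by linarith
  have hq0 : 0 ≤ q := by linarith
  set r : ℝ := 2 / (2 * q - 3) with hr
  have h2q3 : 0 < 2 * q - 3 := by linarith
  have hr0 : 0 ≤ r := by rw [hr]; exact div_nonneg zero_le_two h2q3.le
  have hr1 : r ≤ 1 := by rw [hr, div_le_one h2q3]; linarith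
  refine ⟨l, hl, q, hq32, fun t x => m t x + ‖A t x‖, fun t x =>
    add_nonneg (hm0 t x) (norm_nonneg _), ?_, ?_⟩
  · -- ### the min–max clause on the same plane (Weyl)
    intro t ht x hx
    obtain ⟨v, w, hv, hw, hvw, hpl⟩ := hclause t ht x hx
    exact ⟨v, w, hv, hw, hvw, plane_form_le_add_opNorm hv hw hvw hpl⟩
  · -- ### the mixed norm
    obtain ⟨K, hKtop, hK⟩ := resolved_rpow_le hν.le hcl hLH R hl hq
    obtain ⟨hGfin, -⟩ := hLH.lintegral_frobeniusNormSq_fderiv_of_classical hcl hT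
    obtain ⟨Gm, hGm, hGm_eq⟩ := exists_measurable_dissipation_slice hcl
    set C₂ : ℝ≥0∞ := ((2 : ℝ≥0∞) ^ (q - 1)) ^ r with hC₂
    have hC₂top : C₂ ≠ ⊤ :=
      ENNReal.rpow_ne_top_of_nonneg hr0 (ENNReal.rpow_ne_top_of_nonneg (by linarith) ENNReal.ofNat_ne_top)
    -- pointwise-in-time bound by `C₂ (I_m(t)^r + K (1 + Gm t))`
    have hpt : ∀ t ∈ Ioo 0 T,
        (∫⁻ x in {x : EuclideanSpace ℝ (Fin 3) | l < ‖u t x‖},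
            ENNReal.ofReal (m t x + ‖A t x‖) ^ q) ^ r ≤
          C₂ * ((∫⁻ x in {x : EuclideanSpace ℝ (Fin 3) | l < ‖u t x‖},
            ENNReal.ofReal (m t x) ^ q) ^ r + K * (1 + Gm t)) := by
      intro t ht
      have ht' : t ∈ Ico 0 T := Ioo_subset_Ico_self ht
      set F : Set (EuclideanSpace ℝ (Fin 3)) := {x | l < ‖u t x‖} with hF
      -- measurability of the resolved integrand in `x`
      have hsmooth : ContDiff ℝ 1 (u t) := (hcl.contDiff_velocity ht').of_le (by norm_cast)
      have hAcont : Continuous (A t) := by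
        rw [hA]
        exact continuous_setAverage_closedBall (hsmooth.continuous_fderiv one_ne_zero) R
      have hAmeas : AEMeasurable (fun x => ENNReal.ofReal ‖A t x‖ ^ q) (volume.restrict F) :=
        ((hAcont.norm.measurable.ennreal_ofReal).pow_const q).aemeasurable
      -- pointwise convexity `(m + a)^q ≤ 2^{q-1} (m^q + a^q)`
      have hconv : ∀ x, ENNReal.ofReal (m t x + ‖A t x‖) ^ q ≤
          (2 : ℝ≥0∞) ^ (q - 1) * (ENNReal.ofReal (m t x) ^ q + ENNReal.ofReal ‖A t x‖ ^ q) := by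
        intro x
        rw [ENNReal.ofReal_add (hm0 t x) (norm_nonneg _)]
        exact ENNReal.rpow_add_le_mul_rpow_add_rpow _ _ hq1
      -- split the inner integral
      have hinner : (∫⁻ x in F, ENNReal.ofReal (m t x + ‖A t x‖) ^ q) ≤
          (2 : ℝ≥0∞) ^ (q - 1) * ((∫⁻ x in F, ENNReal.ofReal (m t x) ^ q) +
            ∫⁻ x in F, ENNReal.ofReal ‖A t x‖ ^ q) := by
        calc (∫⁻ x in F, ENNReal.ofReal (m t x + ‖A t x‖) ^ q)
            ≤ ∫⁻ x in F, (2 : ℝ≥0∞) ^ (q - 1) *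
                (ENNReal.ofReal (m t x) ^ q + ENNReal.ofReal ‖A t x‖ ^ q) :=
              lintegral_mono fun x => hconv x
          _ = (2 : ℝ≥0∞) ^ (q - 1) * ((∫⁻ x in F, ENNReal.ofReal (m t x) ^ q) +
                ∫⁻ x in F, ENNReal.ofReal ‖A t x‖ ^ q) := by
              rw [lintegral_const_mul' _ _ (ENNReal.rpow_ne_top_of_nonneg (by linarith)
                ENNReal.ofNat_ne_top), lintegral_add_right' _ hAmeas]
      -- raise to the power `r ≤ 1` and use B2
      have hres : (∫⁻ x in F, ENNReal.ofReal ‖A t x‖ ^ q) ^ r ≤ K * (1 + Gm t) := by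
        rw [hGm_eq t ht]
        exact hK t ht'
      calc (∫⁻ x in F, ENNReal.ofReal (m t x + ‖A t x‖) ^ q) ^ r
          ≤ ((2 : ℝ≥0∞) ^ (q - 1) * ((∫⁻ x in F, ENNReal.ofReal (m t x) ^ q) +
              ∫⁻ x in F, ENNReal.ofReal ‖A t x‖ ^ q)) ^ r := ENNReal.rpow_le_rpow hinner hr0
        _ = C₂ * ((∫⁻ x in F, ENNReal.ofReal (m t x) ^ q) +
              ∫⁻ x in F, ENNReal.ofReal ‖A t x‖ ^ q) ^ r := by
            rw [ENNReal.mul_rpow_of_nonneg _ _ hr0, hC₂]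
        _ ≤ C₂ * ((∫⁻ x in F, ENNReal.ofReal (m t x) ^ q) ^ r +
              (∫⁻ x in F, ENNReal.ofReal ‖A t x‖ ^ q) ^ r) :=
            mul_le_mul_right (ENNReal.rpow_add_le_add_rpow _ _ hr0 hr1) _
        _ ≤ C₂ * ((∫⁻ x in F, ENNReal.ofReal (m t x) ^ q) ^ r + K * (1 + Gm t)) :=
            mul_le_mul_right (add_le_add le_rfl hres) _
    -- ### integrate in time
    have hmaj : AEMeasurable (fun t => K * (1 + Gm t)) (volume.restrict (Ioo 0 T)) :=
      ((hGm.const_add 1).const_mul K).aemeasurable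
    have hle : ∫⁻ t in Ioo 0 T, (∫⁻ x in {x : EuclideanSpace ℝ (Fin 3) | l < ‖u t x‖},
          ENNReal.ofReal (m t x + ‖A t x‖) ^ q) ^ r ≤
        ∫⁻ t in Ioo 0 T, C₂ * ((∫⁻ x in {x : EuclideanSpace ℝ (Fin 3) | l < ‖u t x‖},
          ENNReal.ofReal (m t x) ^ q) ^ r + K * (1 + Gm t)) := by
      refine lintegral_mono_ae ?_
      filter_upwards [ae_restrict_mem measurableSet_Ioo] with t ht
      exact hpt t ht
    refine lt_of_le_of_lt hle ?_
    rw [lintegral_const_mul' _ _ hC₂top, lintegral_add_right' _ hmaj]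
    refine ENNReal.mul_lt_top hC₂top.lt_top (ENNReal.add_lt_top.2 ⟨hint, ?_⟩)
    -- the resolved majorant is integrable: `K (T + ∫₀ᵀ∫ |∇u|²_F) < ∞`
    have hGm_int : ∫⁻ t in Ioo 0 T, Gm t =
        ∫⁻ t in Ioo 0 T, ∫⁻ y, ENNReal.ofReal (frobeniusNormSq (fderiv ℝ (u t) y)) :=
      setLIntegral_congr_fun measurableSet_Ioo hGm_eq
    rw [lintegral_const_mul' _ _ hKtop, lintegral_add_left measurable_const, lintegral_const,
      Measure.restrict_apply_univ, Real.volume_Ioo, hGm_int]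
    refine ENNReal.mul_lt_top hKtop.lt_top ?_
    exact ENNReal.add_lt_top.2 ⟨by rw [one_mul]; exact ENNReal.ofReal_lt_top, hGfin.lt_top⟩

end Summit.NavierStokesRegularity.NavierStokesRegularity.Theorems.FastClassSqueeze.WeylSplit

end
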